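import Literature.AlgebraicGeometry.Frobenioids.PadicKummerThm24iGalois
import Literature.AlgebraicGeometry.Frobenioids.KummerCupProductFN
import HarnessLib

/-!
# Frobenioids II, Def. 2.2 (ii) / Thm. 2.4 (i): local duality and Theorem 2.4 (i) are invariants of
# the context-isomorphism class — Theorem 2.4 (i) for contexts Galois-bound UP TO ISOMORPHISM

Mochizuki, *The geometry of Frobenioids II*, Kyushu J. Math. **62** (2008) 401–460, §2, Definition 2.2
(ii) p. 18 ("by the well-known duality theory of nonarchimedean local fields … the cup product on group
cohomology determines an isomorphism `H¹(H, μ_N(A)) ⥲ H^ab ⊗ H²(H, μ_N(A))`") and Theorem 2.4 (i)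
pp. 19–20 [cite: MochizukiFrdII2008, Thm 2.4 (i) p.19].

PROOF-ONLY file (seat abc-iut-L1-t7, gen 4; cell row W12). In print the Definition 2.2 context of an
object `A` of a `p`-adic Frobenioid is not LITERALLY the Galois-level context
`Def22Context.ofGalois …` of abc-iut-L1-t7 (`G_K` acting through `Gal(L/K)` on a submonoid of `L`):
it is only ISOMORPHIC to it — `G = Im(Π) ≅ G_K`, `Aut_E(A_E) ≅ Gal(K_A/K)`, `O^▷(A) ≅ O^▷_{K_A}`
([FrdII] Thm. 1.2 (ii), Rmk. 2.2.1). This file removes that gap on the cohomological side once and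
for all: every input of Theorem 2.4 (i) that was discharged AT `ofGalois` is transported along an
arbitrary isomorphism of contexts (abc-iut-L1-t7's `Def22Context.Iso`), so that Theorem 2.4 (i)
holds — conditional on exactly `hfs` — for ANY two contexts each of which is isomorphic to a Galois
context over a finite extension of `ℚ_p`:
* `Iso.locallyCompactSpace_H`, `Iso.cupDualHOf_bijective_iff` — local compactness of `H` and the
  bijectivity of the adjoint cup product `H¹(H, μ_N(A)) → Hom(H¹(H, ℤ/N), H²(H, μ_N(A)))` (the LCFT
  input `hH`) are invariant under context isomorphisms (abc-iut-w5-d207's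
  `ContPairing.cupAdjoint_bijective_iff` along `H₁ ⥲ H₂`, `(H₁)_{A₁} ⥲ (H₂)_{A₂}`,
  `μ_N(A₁) ⥲ μ_N(A₂)` — abc-iut-L1-d4's `transportMu` / `transportTriv`);
* `cupDualHOf_bijective_of_isoGalois`, `nonempty_fn_equiv_zmod_of_isoGalois` — hence `hH` and
  "`F_N(A) ≅ ℤ/Nℤ`" hold for every context isomorphic to an `ofGalois` context over `K ⊇ ℚ_p` finite;
* **`thm24i_of_isoGalois`** — Theorem 2.4 (i) (`PadicKummer.Thm24i`, with the cup-product duality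
  isomorphisms `dualityIsoOfLocalDuality`) for an isomorphism `e : X₁ ≅ X₂` of two such contexts,
  `p₁ = p₂` from [AbsAnab] Prop. 1.2.1 (i) applied to the composite Galois-context isomorphism
  `g₁⁻¹ ≫ e ≫ g₂` (abc-iut-L1-d4's `residueChar_eq_of_iso_ofGalois`, inlined); conditional on
  EXACTLY `hfs`.
This is the interface the Frobenioid-level binding ("Iso-from-`Ψ`", cell row W12 (α)) consumes: it
has to PRODUCE contexts and context isomorphisms only, no cohomology. Nothing here concerns
[IUTchIII]; classical; universe `0`.
-/

noncomputable section

namespace Literature.AlgebraicGeometry.Frobenioids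

namespace PadicKummer

namespace Def22Context

open Field IntermediateField Kummer Function
open Literature.NumberTheory.GaloisRepresentations
open Literature.AnabelianGeometry.AbsoluteAnabelian

/-! ### Invariance of the inputs under context isomorphisms -/

namespace Iso

variable {X₁ X₂ : Def22Context} (e : Def22Context.Iso X₁ X₂) (N : ℕ)

include e in
/-- `H₂` is locally compact if `H₁` is (`H₁ ⥲ H₂` is a homeomorphism, `e.isoH`).
[cite: MochizukiFrdII2008, Thm 2.4 (i) p.19] -/
theorem locallyCompactSpace_H [LocallyCompactSpace X₁.H] : LocallyCompactSpace X₂.H :=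
  e.isoH.symm.toHomeomorph.isOpenEmbedding.locallyCompactSpace

include e in
/-- **The LCFT input `hH` is an invariant of the context-isomorphism class**: along an isomorphism
of Definition 2.2 contexts, the adjoint cup product
`H¹(H₁, μ_N(A₁)) → Hom(H¹(H₁, ℤ/N), H²(H₁, μ_N(A₁)))` is bijective iff the one of `(H₂, A₂)` is
(transport of continuous cohomology and cup products along `H₁ ⥲ H₂` with the coefficient
isomorphisms `μ_N(A₁) ⥲ μ_N(A₂)`, `ℤ/N = ℤ/N`). [cite: MochizukiFrdII2008, Def 2.2 (ii) p.18] -/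
theorem cupDualHOf_bijective_iff [LocallyCompactSpace X₁.H] [LocallyCompactSpace X₂.H] :
    Bijective (cupDualHOf X₁ N) ↔ Bijective (cupDualHOf X₂ N) :=
  ContPairing.cupAdjoint_bijective_iff
    (muPowPairingH N X₁.O X₁.HA X₁.qHA) (muPowPairingH N X₂.O X₂.HA X₂.qHA)
    (e.transportMu N).d' (e.transportMu N).d (e.transportMu N).d_d' (e.transportMu N).d'_d
    (e.transportMu N).fH' (e.transportMu N).fH
    (fun x => (e.transportMu N).f_f' x) (fun x => (e.transportMu N).f'_f x)
    (e.transportTriv N).fH' (e.transportTriv N).fH (fun _ => rfl) (fun _ => rfl)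
    (e.transportMu N).fH' (e.transportMu N).fH
    (fun x => (e.transportMu N).f_f' x) (fun x => (e.transportMu N).f'_f x)
    (fun x k => e.transportMu_f'_muPowPairing N x k)

include e in
/-- "`F_N(A) ≅ ℤ/Nℤ`" is an invariant of the context-isomorphism class (`e.isoFN`).
[cite: MochizukiFrdII2008, Def 2.2 (ii) p.18] -/
theorem nonempty_fn_equiv_zmod_iff :
    Nonempty (FN X₁ N ≃+ ZMod N) ↔ Nonempty (FN X₂ N ≃+ ZMod N) :=
  ⟨fun ⟨f⟩ => ⟨(e.isoFN N).symm.trans f⟩, fun ⟨f⟩ => ⟨(e.isoFN N).trans f⟩⟩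

end Iso

/-! ### Contexts isomorphic to a Galois context over a finite extension of `ℚ_p` -/

section IsoGalois

variable (p : ℕ) [Fact p.Prime] {K : Type} [Field K] [Algebra ℚ_[p] K] [FiniteDimensional ℚ_[p] K]
  {L : IntermediateField K (AlgebraicClosure K)} [Normal K L] [FiniteDimensional K L]
  {H : Subgroup (absoluteGaloisGroup K)} [H.Normal] {hH : IsOpen (H : Set (absoluteGaloisGroup K))}
  {AutC O : Type} [Group AutC] [CommMonoid O] [IsCancelMul O] [MulDistribMulAction AutC O]
  [MulDistribMulAction (L ≃ₐ[K] L) O] {res : AutC →* (L ≃ₐ[K] L)}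
  {res_smul : ∀ (α : AutC) (x : O), res α • x = α • x}
  {X : Def22Context} (g : Iso X (ofGalois L H hH res res_smul)) {N : ℕ} (m : MuModel L O N)

omit [FiniteDimensional ℚ_[p] K] in
include p g in
/-- `H` is locally compact for a context isomorphic to a Galois context over `K ⊇ ℚ_p` finite.
[cite: MochizukiFrdII2008, Def 2.2 (i) p.17] -/
theorem locallyCompactSpace_H_of_isoGalois : LocallyCompactSpace X.H :=
  haveI := locallyCompactSpace_H_ofGalois_mlf p L H hH res res_smul
  g.symm.locallyCompactSpace_H

include p g m in
/-- **Local Tate duality (`hH`) for every context isomorphic to a Galois context** over a finite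
extension `K` of `ℚ_p` (with `μ_N(A) ≅ μ_N(K̄)` on the Galois side): transported from
`cupDualH_bijective_ofGalois_mlf` along the context isomorphism.
[cite: MochizukiFrdII2008, Def 2.2 (ii) p.18] -/
theorem cupDualHOf_bijective_of_isoGalois [NeZero N] [LocallyCompactSpace X.H] :
    Bijective (cupDualHOf X N) :=
  haveI := locallyCompactSpace_H_ofGalois_mlf p L H hH res res_smul
  (g.cupDualHOf_bijective_iff N).2 (cupDualH_bijective_ofGalois_mlf p L H hH res res_smul m)

include p g m in
/-- **"`F_N(A) ≅ ℤ/Nℤ`" for every `(N, H)`-saturated context isomorphic to a Galois context** over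
`K ⊇ ℚ_p` finite. [cite: MochizukiFrdII2008, Def 2.2 (ii) p.18] -/
theorem nonempty_fn_equiv_zmod_of_isoGalois [NeZero N] (h : IsNHSaturated X N) :
    Nonempty (FN X N ≃+ ZMod N) :=
  (g.nonempty_fn_equiv_zmod_iff N).2
    (nonempty_fn_equiv_zmod_ofGalois_mlf p L H hH res res_smul m ((g.isNHSaturated_iff N).1 h))

include g in
/-- `H_A` is finite for a context isomorphic to a Galois context (`Gal(L/K)` is finite).
[cite: MochizukiFrdII2008, Def 2.2 (i) p.17] -/
theorem finite_HA_of_isoGalois : Finite X.HA := g.symm.finite_HA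

end IsoGalois

/-! ### Theorem 2.4 (i) for contexts Galois-bound up to isomorphism -/

section Thm24iIsoGalois

variable {p₁ p₂ : ℕ} [Fact p₁.Prime] [Fact p₂.Prime]
  {K₁ : Type} [Field K₁] [Algebra ℚ_[p₁] K₁] [FiniteDimensional ℚ_[p₁] K₁]
  {K₂ : Type} [Field K₂] [Algebra ℚ_[p₂] K₂] [FiniteDimensional ℚ_[p₂] K₂]
  {L₁ : IntermediateField K₁ (AlgebraicClosure K₁)} [Normal K₁ L₁] [FiniteDimensional K₁ L₁]
  {H₁ : Subgroup (absoluteGaloisGroup K₁)} [H₁.Normal]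
  {hH₁ : IsOpen (H₁ : Set (absoluteGaloisGroup K₁))}
  {AutC₁ O₁ : Type} [Group AutC₁] [CommMonoid O₁] [IsCancelMul O₁] [MulDistribMulAction AutC₁ O₁]
  [MulDistribMulAction (L₁ ≃ₐ[K₁] L₁) O₁] {res₁ : AutC₁ →* (L₁ ≃ₐ[K₁] L₁)}
  {res_smul₁ : ∀ (α : AutC₁) (x : O₁), res₁ α • x = α • x}
  {L₂ : IntermediateField K₂ (AlgebraicClosure K₂)} [Normal K₂ L₂] [FiniteDimensional K₂ L₂]
  {H₂ : Subgroup (absoluteGaloisGroup K₂)} [H₂.Normal]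
  {hH₂ : IsOpen (H₂ : Set (absoluteGaloisGroup K₂))}
  {AutC₂ O₂ : Type} [Group AutC₂] [CommMonoid O₂] [IsCancelMul O₂] [MulDistribMulAction AutC₂ O₂]
  [MulDistribMulAction (L₂ ≃ₐ[K₂] L₂) O₂] {res₂ : AutC₂ →* (L₂ ≃ₐ[K₂] L₂)}
  {res_smul₂ : ∀ (α : AutC₂) (x : O₂), res₂ α • x = α • x}
  {X₁ X₂ : Def22Context}
  (g₁ : Iso X₁ (ofGalois L₁ H₁ hH₁ res₁ res_smul₁)) (g₂ : Iso X₂ (ofGalois L₂ H₂ hH₂ res₂ res_smul₂))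
  (e : Iso X₁ X₂) (N : ℕ) [NeZero N] (m₁ : MuModel L₁ O₁ N) (m₂ : MuModel L₂ O₂ N)
  [Finite X₁.HA] [Finite X₂.HA] [LocallyCompactSpace X₁.H] [LocallyCompactSpace X₂.H]

/-- **Theorem 2.4 (i) for any two Definition 2.2 contexts that are Galois-bound up to context
isomorphism** (`gᵢ : Xᵢ ≅ ofGalois Lᵢ Hᵢ …` over finite extensions `Kᵢ ⊇ ℚ_{pᵢ}`, with
`μ_N ≅ μ_N(K̄ᵢ)` on the Galois side) and any context isomorphism `e : X₁ ≅ X₂` "induced by `Ψ`":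
for `A₁` `(N, H₁)`-saturated and any normalisation `F_N(A₁) ≅ ℤ/Nℤ`, the typed `Thm24i` holds for
`e.thm24Data N` and the cup-product duality isomorphisms of `X₁`, `X₂` (their local-duality inputs
transported from the Galois side, `cupDualHOf_bijective_of_isoGalois`): "`Φ₁` fieldwise saturated
iff `Φ₂`" is the hypothesis `hfs` ([FrdI] Cor. 4.10/4.11, Frobenioid side); "`p₁ = p₂`", the
saturation transfer and the Kummer / reciprocity compatibilities are PROVED. Conditional on exactly
`hfs`. [cite: MochizukiFrdII2008, Thm 2.4 (i) p.19] -/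
theorem thm24i_of_isoGalois (fs₁ fs₂ : Prop) (hfs : fs₁ ↔ fs₂) (eFN₁ : FN X₁ N ≃+ ZMod N)
    (hc₁ : IsNHSaturated X₁ N) :
    Thm24i X₁ X₂ N p₁ p₂ fs₁ fs₂ (e.thm24Data N)
      (X₁.dualityIsoOfLocalDuality N eFN₁ hc₁ (cupDualHOf_bijective_of_isoGalois p₁ g₁ m₁))
      (X₂.dualityIsoOfLocalDuality N ((e.isoFN N).symm.trans eFN₁) ((e.isNHSaturated_iff N).mp hc₁)
        (cupDualHOf_bijective_of_isoGalois p₂ g₂ m₂)) :=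
  e.thm24i_of_cupProduct N p₁ p₂ fs₁ fs₂
    (residueChar_eq_of_iso_ofGalois (g₁.symm.trans (e.trans g₂)) galoisMLF_iso_residueChar_eq_holds)
    hfs eFN₁ hc₁
    (cupDualHOf_bijective_of_isoGalois p₁ g₁ m₁) (cupDualHOf_bijective_of_isoGalois p₂ g₂ m₂)

/-- **Theorem 2.4 (i) for contexts Galois-bound up to isomorphism, both normalisations given.**
[cite: MochizukiFrdII2008, Thm 2.4 (i) p.19] -/
theorem thm24i_of_isoGalois₂ (fs₁ fs₂ : Prop) (hfs : fs₁ ↔ fs₂) (eFN₁ : FN X₁ N ≃+ ZMod N)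
    (eFN₂ : FN X₂ N ≃+ ZMod N) (hc₁ : IsNHSaturated X₁ N) (hc₂ : IsNHSaturated X₂ N) :
    Thm24i X₁ X₂ N p₁ p₂ fs₁ fs₂ (e.thm24Data N)
      (X₁.dualityIsoOfLocalDuality N eFN₁ hc₁ (cupDualHOf_bijective_of_isoGalois p₁ g₁ m₁))
      (X₂.dualityIsoOfLocalDuality N eFN₂ hc₂ (cupDualHOf_bijective_of_isoGalois p₂ g₂ m₂)) :=
  e.thm24i_of_cupProduct₂ N p₁ p₂ fs₁ fs₂
    (residueChar_eq_of_iso_ofGalois (g₁.symm.trans (e.trans g₂)) galoisMLF_iso_residueChar_eq_holds)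
    hfs eFN₁ eFN₂ hc₁ hc₂
    (cupDualHOf_bijective_of_isoGalois p₁ g₁ m₁) (cupDualHOf_bijective_of_isoGalois p₂ g₂ m₂)

end Thm24iIsoGalois

end Def22Context

end PadicKummer

end Literature.AlgebraicGeometry.Frobenioids

end
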